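import Summits.CriticalPhenomena.CardyFormulaZ2.Theorems.CardyBoundaryCoulombGasBoundaryDefectGaussianRStubTransferPart5
import Literature.Probability.LatticeModels.CollarLegModel
import Literature.Probability.LatticeModels.DirichletGreenFunction
import Literature.Probability.LatticeModels.DomainDiscretisation
import Literature.Probability.LatticeModels.LatticeGraphProofs
import Literature.Probability.RandomPlanarGeometry.PlanarDomains

/-!
# Stub `stub_greenKernelAsymptotics` of line `rainbow-monomials-in-excursion-kernels` — Part 4:
# the boundary–boundary Green kernel from two boundary–interior limits
# (crux `BoundaryDefectGaussianR`, stmt-CriticalPhenomena-14132)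

The registered stub says: at two distinct flat boundary points `x, y` of a rectilinear Jordan
domain `D` with uniformizer `w : D → ℍ`, the Dirichlet Green function of the lattice
approximation `V_n = {v : δ_n v ∈ D̄}` at boundary-row points `a_n → x`, `b_n → y` satisfies
`G_{V_n}(a_n,b_n)/δ_n² → c·|w′(x)||w′(y)|/|w(x)−w(y)|²` (`c = 1/π`). This file proves the
REDUCTION of that statement to two boundary–interior limits at an auxiliary interior point
`u ∈ D` with lattice points `c_n → u` (`greenKernelAsymptotics_of_limits`):

* (A) `G_{V_n}(c_n,b_n)/δ_n → (1/π) Im w(u) |w′(y)| / |w(u) − w(y)|²` — the flat-edge Poisson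
  kernel limit (Kenyon 2000, Cor. 19);
* (B) `G_{V_n}(c_n,b_n) δ_n / G_{V_n}(a_n,b_n) → [Im w(u)/|w(u)−w(y)|²]·[|w(x)−w(y)|²/|w′(x)|]` —
  the discrete Poisson kernel with pole `b_n`, normalised at the straight boundary point `a_n`,
  converges to the continuum one normalised by inner normal derivative `1` at `x`
  (Chelkak–Smirnov 2011, Thm. 3.13);

since `G(a_n,b_n)/δ² = (A-quantity)/(B-quantity)` as soon as `G(c_n,b_n) ≠ 0` (forced
eventually by the positive limit (A)), and the quotient of the limits is
`(1/π)|w′(x)||w′(y)|/|w(x)−w(y)|²` because `Im w(u) > 0`, `w(u) ≠ w(y)`, `w′(x) ≠ 0`, `w′(y) ≠ 0`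
and `w(x) ≠ w(y)` — the last three by the flat-point conformal geometry of
`…StubTransferPart3/4/5` (`transfer_deriv_ne_zero`, `transfer_boundary_injective`), packaged
here for the stubs' `im/re` flatness clause (`green_deriv_ne_zero_of_flat`). Part 5 names the
two limits as cited Literature facts and derives the stub's statement verbatim from them.

Also here: the transcription between the stubs' `ℤ × ℤ` phrasing (`CollarLegModel.neighbours`,
mesh embedding `v ↦ v₁δ + v₂δ·I`) and the tree's `Site 2` vocabulary (`meshPoint`,
`(zdGraph 2).neighborFinset`) — `green_meshPoint_toSite`, `green_mem_image_toSite`,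
`green_card_filter_toSite` (registered sub-goal `s11_neighbourTranscription`). All [folklore].
-/

noncomputable section

open Filter Topology Set Metric
open Literature.Probability.RandomPlanarGeometry Literature.Probability.LatticeModels

namespace Summit.CriticalPhenomena.CardyFormulaZ2.Cruxes.BoundaryDefectGaussianR.RainbowMonomialsInExcursionKernels

/-! ### Transcription `ℤ × ℤ ↔ Site 2` -/

/-- The embedding `ℤ × ℤ → Site 2 = (Fin 2 → ℤ)`, `v ↦ ![v.1, v.2]`, used by the stubs of the
line, is injective. [folklore] -/
theorem green_toSite_injective : Function.Injective (fun p : ℤ × ℤ => (![p.1, p.2] : Site 2)) := by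
  intro u v h
  have h0 := congrFun h 0
  have h1 := congrFun h 1
  simp only [Matrix.cons_val_zero, Matrix.cons_val_one] at h0 h1
  exact Prod.ext h0 h1

/-- The tree's `meshPoint δ` of `![v.1, v.2]` is the stubs' mesh point `v₁ δ + v₂ δ I`.
[folklore] -/
theorem green_meshPoint_toSite (δ : ℝ) (v : ℤ × ℤ) :
    meshPoint δ (![v.1, v.2] : Site 2) =
      (v.1 : ℂ) * ((δ : ℝ) : ℂ) + (v.2 : ℂ) * ((δ : ℝ) : ℂ) * Complex.I := by
  apply Complex.ext <;> simp [meshPoint] <;> ring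

/-- Membership in the image of a finite set of `ℤ × ℤ` under `v ↦ ![v.1, v.2]`. [folklore] -/
theorem green_mem_image_toSite (V : Finset (ℤ × ℤ)) (v' : Site 2) :
    v' ∈ V.image (fun p : ℤ × ℤ => (![p.1, p.2] : Site 2)) ↔ (v' 0, v' 1) ∈ V := by
  constructor
  · intro h
    obtain ⟨v, hv, rfl⟩ := Finset.mem_image.1 h
    simpa using hv
  · intro h
    exact Finset.mem_image.2 ⟨_, h, by ext i; fin_cases i <;> rfl⟩

/-- The `ℤ²`-neighbours of `![v.1, v.2]` are the images of the four
`CollarLegModel.neighbours` of `v`. [folklore] -/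
theorem green_neighborFinset_toSite (v : ℤ × ℤ) :
    (zdGraph 2).neighborFinset (![v.1, v.2] : Site 2) =
      (CollarLegModel.neighbours v).image (fun p : ℤ × ℤ => (![p.1, p.2] : Site 2)) := by
  ext u'
  rw [SimpleGraph.mem_neighborFinset, Finset.mem_image, zdGraph_adj_iff]
  constructor
  · rintro ⟨i, h | h⟩
    · fin_cases i
      · refine ⟨(v.1 + 1, v.2), by simp [CollarLegModel.neighbours], ?_⟩
        rw [h]; ext j; fin_cases j <;> simp
      · refine ⟨(v.1, v.2 + 1), by simp [CollarLegModel.neighbours], ?_⟩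
        rw [h]; ext j; fin_cases j <;> simp
    · fin_cases i
      · refine ⟨(v.1 - 1, v.2), by simp [CollarLegModel.neighbours], ?_⟩
        have h0 := congrFun h 0
        have h1 := congrFun h 1
        simp at h0 h1
        ext j; fin_cases j <;> simp <;> omega
      · refine ⟨(v.1, v.2 - 1), by simp [CollarLegModel.neighbours], ?_⟩
        have h0 := congrFun h 0
        have h1 := congrFun h 1
        simp at h0 h1
        ext j; fin_cases j <;> simp <;> omega
  · rintro ⟨u, hu, rfl⟩
    simp only [CollarLegModel.neighbours, Finset.mem_insert, Finset.mem_singleton] at hu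
    rcases hu with rfl | rfl | rfl | rfl
    · exact ⟨0, Or.inl (by ext j; fin_cases j <;> simp)⟩
    · exact ⟨1, Or.inl (by ext j; fin_cases j <;> simp)⟩
    · exact ⟨0, Or.inr (by ext j; fin_cases j <;> simp)⟩
    · exact ⟨1, Or.inr (by ext j; fin_cases j <;> simp)⟩

/-- The number of lattice neighbours outside the domain is the same in both phrasings: for
`V ⊆ ℤ × ℤ` and `v`, the `ℤ²`-neighbours of `![v.1,v.2]` outside the image of `V` are in bijection
with the `CollarLegModel.neighbours` of `v` outside `V`. [folklore] -/
theorem green_card_filter_toSite (V : Finset (ℤ × ℤ)) (v : ℤ × ℤ) :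
    (((zdGraph 2).neighborFinset (![v.1, v.2] : Site 2)).filter
        (fun u => u ∉ V.image (fun p : ℤ × ℤ => (![p.1, p.2] : Site 2)))).card =
      ((CollarLegModel.neighbours v).filter (fun u => u ∉ V)).card := by
  rw [green_neighborFinset_toSite, Finset.filter_image,
    Finset.card_image_of_injective _ green_toSite_injective]
  congr 1
  refine Finset.filter_congr fun u _ => ?_
  rw [green_toSite_injective.mem_finset_image]

/-- **Registered sub-goal `s11_neighbourTranscription` of stub 5** (stmt-CriticalPhenomena-14132):
the stubs' boundary-row condition "exactly one of the four `CollarLegModel.neighbours` of `v`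
lies outside `V`" is the tree-vocabulary condition "exactly one `ℤ²`-neighbour of `![v.1, v.2]`
lies outside the image of `V` in `Site 2`" (`green_card_filter_toSite`), by which the cited
`Site 2` facts of Part 5 apply to the stubs' `ℤ × ℤ` data. [folklore] -/
theorem s11_neighbourTranscription : ∀ (V : Finset (ℤ × ℤ)) (v : ℤ × ℤ), (((Literature.Probability.LatticeModels.zdGraph 2).neighborFinset (![v.1, v.2] : Literature.Probability.LatticeModels.Site 2)).filter (fun u => u ∉ V.image (fun p : ℤ × ℤ => (![p.1, p.2] : Fin 2 → ℤ)))).card = ((Literature.Probability.LatticeModels.CollarLegModel.neighbours v).filter (fun u => u ∉ V)).card :=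
  fun V v => green_card_filter_toSite V v

/-! ### Non-degeneracy of the uniformizer at flat boundary points -/

/-- **The uniformizer is conformal up to a flat boundary point and real next to it.** For a
Jordan domain `D`, `w` holomorphic on an open `U ⊇ D` and bijective `D → ℍ`, and a boundary point
`p ∈ U` at which `∂D` is flat in the stubs' sense (horizontal or vertical within distance `r`):
`w′(p) ≠ 0`, and `w` is real on `∂D` near `p`. Assembled from `transfer_flat_dir`,
`transfer_halfBall_subset`, `transfer_deriv_ne_zero`, `transfer_im_eq_zero_of_frontier`
(`…StubTransferPart3–5`). [folklore] -/
theorem green_deriv_ne_zero_of_flat (D : JordanDomain) {w : ℂ → ℂ} {U : Set ℂ} (hU : IsOpen U)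
    (hDU : D.carrier ⊆ U) (hw : DifferentiableOn ℂ w U)
    (hbij : Set.BijOn w D.carrier {z : ℂ | 0 < z.im}) {p : ℂ} (hp : p ∈ frontier D.carrier)
    (hpU : p ∈ U)
    (hflat : ∃ r : ℝ, 0 < r ∧ ((∀ z ∈ frontier D.carrier, dist z p < r → z.im = p.im) ∨
      (∀ z ∈ frontier D.carrier, dist z p < r → z.re = p.re))) :
    deriv w p ≠ 0 ∧ ∃ r : ℝ, 0 < r ∧ ∀ z ∈ frontier D.carrier, dist z p < r → (w z).im = 0 := by
  obtain ⟨r₀, hr₀, hfl₀⟩ := hflat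
  obtain ⟨r₁, hr₁, hr₁U⟩ := Metric.isOpen_iff.mp hU p hpU
  obtain ⟨τ₀, hτ₀, h⟩ := transfer_flat_dir hfl₀
  have hpos : ∀ z ∈ D.carrier, 0 < (w z).im := fun z hz ↦ hbij.mapsTo hz
  have hr : 0 < min r₀ r₁ := lt_min hr₀ hr₁
  have hfl : ∀ z ∈ frontier D.carrier, dist z p < min r₀ r₁ → ((z - p) / τ₀).im = 0 :=
    fun z hz hzr ↦ h z hz (lt_of_lt_of_le hzr (min_le_left _ _))
  obtain ⟨ν, hν, hH⟩ := transfer_halfBall_subset D.isOpen hτ₀ hp hr hfl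
  have hν1 : ‖ν‖ = 1 := by
    rcases hν with rfl | rfl
    · rw [norm_mul, hτ₀, Complex.norm_I, mul_one]
    · rw [norm_neg, norm_mul, hτ₀, Complex.norm_I, mul_one]
  refine ⟨transfer_deriv_ne_zero hν1 hr hH hpos
    (transfer_im_eq_zero_of_frontier D.isOpen hU hDU hw hbij hp hpU)
    (hw.analyticAt (hU.mem_nhds hpU)) hbij.injOn, min r₀ r₁, hr, fun z hz hzr ↦ ?_⟩
  exact transfer_im_eq_zero_of_frontier D.isOpen hU hDU hw hbij hz
    (hr₁U (lt_of_lt_of_le hzr (min_le_right _ _)))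

/-! ### The reduction: boundary–boundary kernel from the two boundary–interior limits -/

/-- The exact lattice identity behind the reduction: `G₂/δ² = (G₁/δ)/(G₁δ/G₂)` whenever
`G₁ ≠ 0 ≠ δ` (both sides vanish if `G₂ = 0`). [folklore] -/
theorem green_div_sq_eq {G₁ G₂ δ : ℝ} (h₁ : G₁ ≠ 0) (hδ : δ ≠ 0) :
    G₂ / δ ^ 2 = (G₁ / δ) / (G₁ * δ / G₂) := by
  by_cases h₂ : G₂ = 0
  · simp [h₂]
  · field_simp

/-- **The boundary–boundary Green kernel from two boundary–interior limits.** Let `D` be a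
Jordan domain, `x ≠ y` flat boundary points (stubs' `im/re` clause), `w` holomorphic on an open
`U ⊇ D ∪ {x, y}` and bijective `D → ℍ`, `δ_n > 0`, `u ∈ D`, and `V_n ⊆ ℤ²`, `a_n, b_n, c_n ∈ ℤ²`
ANY data for which
(A) `G_{V_n}(c_n,b_n)/δ_n → (1/π) Im w(u) |w′(y)|/|w(u) − w(y)|²` and
(B) `G_{V_n}(c_n,b_n) δ_n/G_{V_n}(a_n,b_n) → [Im w(u)/|w(u) − w(y)|²]·[|w(x) − w(y)|²/|w′(x)|]`.
Then `G_{V_n}(a_n,b_n)/δ_n² → (1/π)·|w′(x)||w′(y)|/|w(x) − w(y)|²`. Proof: the limit (A) is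
`> 0` and the limit (B) is `≠ 0` (`Im w(u) > 0`, `w(u) ≠ w(y)` as `w(y) ∈ ℝ`, `w′(x), w′(y) ≠ 0`,
`w(x) ≠ w(y)`: `green_deriv_ne_zero_of_flat`, `transfer_boundary_injective`), so eventually
`G(c_n,b_n) ≠ 0` and `G(a_n,b_n)/δ² = (A)/(B)` (`green_div_sq_eq`); the quotient of the limits
is the claimed value. [folklore] -/
theorem greenKernelAsymptotics_of_limits (D : JordanDomain) {x y : ℂ} (hx : x ∈ frontier D.carrier)
    (hy : y ∈ frontier D.carrier) (hxy : x ≠ y)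
    (hflx : ∃ r : ℝ, 0 < r ∧ ((∀ z ∈ frontier D.carrier, dist z x < r → z.im = x.im) ∨
      (∀ z ∈ frontier D.carrier, dist z x < r → z.re = x.re)))
    (hfly : ∃ r : ℝ, 0 < r ∧ ((∀ z ∈ frontier D.carrier, dist z y < r → z.im = y.im) ∨
      (∀ z ∈ frontier D.carrier, dist z y < r → z.re = y.re)))
    {w : ℂ → ℂ} {U : Set ℂ} (hU : IsOpen U) (hDU : D.carrier ⊆ U) (hxU : x ∈ U) (hyU : y ∈ U)
    (hw : DifferentiableOn ℂ w U) (hbij : Set.BijOn w D.carrier {z : ℂ | 0 < z.im})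
    {δ : ℕ → ℝ} (hδ : ∀ n, 0 < δ n) {u : ℂ} (hu : u ∈ D.carrier)
    {V : ℕ → Finset (Site 2)} {a b c : ℕ → Site 2}
    (hA : Tendsto (fun n => dirichletGreen (V n) (c n) (b n) / δ n) atTop
      (𝓝 (1 / Real.pi * ((w u).im * ‖deriv w y‖ / ‖w u - w y‖ ^ 2))))
    (hB : Tendsto (fun n => dirichletGreen (V n) (c n) (b n) * δ n / dirichletGreen (V n) (a n) (b n))
      atTop (𝓝 ((w u).im / ‖w u - w y‖ ^ 2 * (‖w x - w y‖ ^ 2 / ‖deriv w x‖)))) :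
    Tendsto (fun n => dirichletGreen (V n) (a n) (b n) / δ n ^ 2) atTop
      (𝓝 (1 / Real.pi * (‖deriv w x‖ * ‖deriv w y‖ / ‖w x - w y‖ ^ 2))) := by
  -- non-degeneracy of `w` at `u`, `x`, `y`
  have hpos : ∀ z ∈ D.carrier, 0 < (w z).im := fun z hz ↦ hbij.mapsTo hz
  obtain ⟨hdx, rx, hrx, hrealx⟩ := green_deriv_ne_zero_of_flat D hU hDU hw hbij hx hxU hflx
  obtain ⟨hdy, ry, hry, hrealy⟩ := green_deriv_ne_zero_of_flat D hU hDU hw hbij hy hyU hfly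
  have hwx : (w x).im = 0 := transfer_im_eq_zero_of_frontier D.isOpen hU hDU hw hbij hx hxU
  have hwy : (w y).im = 0 := transfer_im_eq_zero_of_frontier D.isOpen hU hDU hw hbij hy hyU
  have hwxy : w x ≠ w y :=
    transfer_boundary_injective D.isOpen hbij.injOn hpos hxy (frontier_subset_closure hx)
      (frontier_subset_closure hy) hwx (hw.analyticAt (hU.mem_nhds hxU)).hasStrictDerivAt hdx
      (hw.analyticAt (hU.mem_nhds hyU)).hasStrictDerivAt hdy hrx hry hrealx hrealy
  have huim : 0 < (w u).im := hpos u hu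
  have huy : w u ≠ w y := fun h => by
    have h' := huim
    rw [h, hwy] at h'
    exact lt_irrefl _ h'
  have h1 : ‖w u - w y‖ ≠ 0 := norm_ne_zero_iff.2 (sub_ne_zero.2 huy)
  have h2 : ‖deriv w x‖ ≠ 0 := norm_ne_zero_iff.2 hdx
  have h2' : ‖deriv w y‖ ≠ 0 := norm_ne_zero_iff.2 hdy
  have h3 : ‖w x - w y‖ ≠ 0 := norm_ne_zero_iff.2 (sub_ne_zero.2 hwxy)
  have hpi : Real.pi ≠ 0 := Real.pi_ne_zero
  -- the two limits are non-degenerate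
  have hα : 0 < 1 / Real.pi * ((w u).im * ‖deriv w y‖ / ‖w u - w y‖ ^ 2) := by
    have := Real.pi_pos
    have h4 : 0 < ‖deriv w y‖ := norm_pos_iff.2 hdy
    have h5 : 0 < ‖w u - w y‖ := norm_pos_iff.2 (sub_ne_zero.2 huy)
    positivity
  have hβ : (w u).im / ‖w u - w y‖ ^ 2 * (‖w x - w y‖ ^ 2 / ‖deriv w x‖) ≠ 0 :=
    mul_ne_zero (div_ne_zero huim.ne' (pow_ne_zero 2 h1)) (div_ne_zero (pow_ne_zero 2 h3) h2)
  -- eventually `G(c_n, b_n) ≠ 0`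
  have hne : ∀ᶠ n in atTop, dirichletGreen (V n) (c n) (b n) ≠ 0 := by
    refine (hA.eventually (lt_mem_nhds hα)).mono fun n hn hzero => ?_
    rw [hzero, zero_div] at hn
    exact lt_irrefl _ hn
  -- the quotient of the two limits
  have key := hA.div hB hβ
  have heq : (fun n => dirichletGreen (V n) (c n) (b n) / δ n) /
      (fun n => dirichletGreen (V n) (c n) (b n) * δ n / dirichletGreen (V n) (a n) (b n))
        =ᶠ[atTop] fun n => dirichletGreen (V n) (a n) (b n) / δ n ^ 2 :=
    hne.mono fun n hn => by
      simp only [Pi.div_apply]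
      exact (green_div_sq_eq hn (hδ n).ne').symm
  have hlim : 1 / Real.pi * ((w u).im * ‖deriv w y‖ / ‖w u - w y‖ ^ 2) /
      ((w u).im / ‖w u - w y‖ ^ 2 * (‖w x - w y‖ ^ 2 / ‖deriv w x‖)) =
      1 / Real.pi * (‖deriv w x‖ * ‖deriv w y‖ / ‖w x - w y‖ ^ 2) := by
    field_simp
  rw [hlim] at key
  exact key.congr' heq

end Summit.CriticalPhenomena.CardyFormulaZ2.Cruxes.BoundaryDefectGaussianR.RainbowMonomialsInExcursionKernels

end
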